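import Mathlib
import Summits.Ventures.PercRepro2.AS3Corr
import Summits.Ventures.PercRepro2.IncBK

/-!
# Every row STEP(0, j+1) is Reimer's inequality on a cube of packing number ≤ j+1
(seat mine-b, cell pub-perc-repro2; conjectures/MINE-B.md §16.5)

The unpinned abstract STEP(0, j+1) of a clutter `B` on the cube `U` is the level-refined Reimer statement
(AS3) for the pair `(B^{□j}, B)` = `(kDisj B j, B)`: `#{lev ρ = 0 ∧ lev γ ≥ j+1} ≤ #{lev ρ = 1 ∧ lev γ ≥ j}`.
Its correction (`Φ = R + c`, AS3Corr.lean) is `c = N(1, ≥ j+1) − N(≥ 2, j)`, whose negative part needs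
`j + 2` pairwise disjoint members of `B` in the cube (two red, `j` blue).  So on a cube with no
`(j+2)`-packing of `B` the correction is non-negative and (AS3) — i.e. STEP(0, j+1) — is Reimer's
inequality for the increasing pair `(B^{□j}, B)` (`AS3_kDisj_of_no_packing`).  `j = 2` is the
STEP(0,3) row (`AS3_root_of_no_four` of StepZeroPacking.lean); `j = 1` is STEP(0,2) = Reimer(B,B),
where the hypothesis is not needed.
-/

open Finset

namespace Summit.Ventures.PercRepro2

namespace StepZero

open ReimerCube

variable {E : Type*} [DecidableEq E]

open Classical

/-- two disjoint `B`-members on the blue side and a `j`-packing on the red side give a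
`(j+2)`-packing of the cube -/
lemma kDisj_add_two_of_dOcc_self (U : Finset E) {B : Finset E → Prop} (hB : Incr B) (j : ℕ)
    {γ : Finset E} (hγ : γ ⊆ U) (h2 : DOcc B B γ) (hj : kDisj B j (U \ γ)) :
    kDisj B (2 + j) U := by
  apply dOcc_kDisj_add B 2 j
  refine ⟨γ, U \ γ, hγ, Finset.sdiff_subset, Finset.disjoint_sdiff, ?_, ?_⟩
  · intro T hT
    have h2' : DOcc B (kDisj B 1) γ :=
      h2.mono_right (fun T' hT' => (kDisj_one_iff hB T').mpr hT')
    exact incr_kDisj B 2 hT h2'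
  · intro T hT
    exact incr_kDisj B j hT hj

/-- on a cube without a `(j+2)`-packing of `B`, no configuration has `B □ B` blue and `B^{□j}` red -/
theorem cM_kDisj_eq_zero_of_no_packing (U : Finset E) {B : Finset E → Prop} (hB : Incr B) (j : ℕ)
    (hν : ¬ kDisj B (j + 2) U) : cM U (kDisj B j) B = 0 := by
  unfold cM
  rw [Finset.card_eq_zero, Finset.filter_eq_empty_iff]
  intro γ hγ
  rw [Finset.mem_powerset] at hγ
  rintro ⟨hBB, hj⟩
  apply hν
  have := kDisj_add_two_of_dOcc_self U hB j hγ hBB hj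
  rwa [Nat.add_comm] at this

/-- **STEP(0, j+1) is Reimer's inequality on every cube of packing number `≤ j+1`**: (AS3) for the
pair `(B^{□j}, B)` when `U` carries no `j+2` pairwise disjoint `B`-members. -/
theorem AS3_kDisj_of_no_packing (U : Finset E) {B : Finset E → Prop} (hB : Incr B) (j : ℕ)
    (hν : ¬ kDisj B (j + 2) U) : AS3 U (kDisj B j) B := by
  apply AS3_of_corr_nonneg U (incr_kDisj B j) hB
  unfold corr
  rw [cM_kDisj_eq_zero_of_no_packing U hB j hν]
  push_cast
  omega

end StepZero

end Summit.Ventures.PercRepro2
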